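import Mathlib.Analysis.InnerProductSpace.Laplacian
import Mathlib.Analysis.Calculus.MeanValue
import Mathlib.Analysis.Calculus.Deriv.Pow
import HarnessLib

/-!
# Second differences, the `2d + 1`-point stencil, and the double stencil of a harmonic function

Analysis/FluidPDE support file (theorems only: no definitions, no named facts). Taylor-free
consistency estimates for the symmetric second difference `F(x + w) + F(x - w) - 2F(x)` of a
`C²` function and for the `2d + 1`-point stencil `Σᵢ (F(x + h bᵢ) + F(x - h bᵢ) - 2F(x))` over an
orthonormal basis `b`, against `h² ΔF(x)` (`InnerProductSpace.laplacian`): the error is controlled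
by the OSCILLATION of the second derivatives along the stencil segments (mean value theorem twice),
hence `o(h²)` locally uniformly for `C²` functions. Consequence (`abs_double_stencil_le_of_laplacian_eq_zero`):
the DOUBLE stencil (two orthonormal frames) of a `C⁴` function harmonic on an open set is `o(h⁴)`
uniformly on compact subsets — the finite-difference shadow of `Δ_a Δ_b k(a - b) = 0`, used for
discrete null vectors of reflection-positive harmonic kernels. No harmonicity of DERIVATIVES of
`k` is needed (only `Δk = 0` and continuity of fourth derivatives).

* `abs_second_difference_sub_le` (dimension one), `abs_second_difference_sub_iteratedFDeriv_le`,
  `abs_stencil_sub_laplacian_le` (error `≤ 2 (card ι) h² ω`);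
* `iteratedFDeriv_two_stencil_apply`, `laplacian_stencil` — derivatives of the stencil;
* `abs_double_stencil_le_of_laplacian_eq_zero`.

## References

* D. Gilbarg, N. S. Trudinger, *Elliptic Partial Differential Equations of Second Order* (2001),
  §2 (harmonic functions; the calculus is folklore). [`GilbargTrudinger2001`]
-/

noncomputable section

open Set Filter InnerProductSpace
open scoped Topology Laplacian

namespace Literature.Analysis.FluidPDE

section OneDim

/-- **Symmetric second difference vs. second derivative, dimension one.** If `g` is twice
differentiable on `[-1, 1]` and `|g'' - L| ≤ ω` there, then `|g(1) + g(-1) - 2g(0) - L| ≤ 2ω`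
(mean value theorem applied to `g' - L·id` and then to `σ ↦ g(σ) + g(-σ) - Lσ²` on `[0, 1]`).
[folklore] -/
theorem abs_second_difference_sub_le {g g' g'' : ℝ → ℝ} {L ω : ℝ}
    (hg : ∀ σ ∈ Icc (-1:ℝ) 1, HasDerivAt g (g' σ) σ)
    (hg' : ∀ σ ∈ Icc (-1:ℝ) 1, HasDerivAt g' (g'' σ) σ)
    (hω : ∀ σ ∈ Icc (-1:ℝ) 1, |g'' σ - L| ≤ ω) :
    |g 1 + g (-1) - 2 * g 0 - L| ≤ 2 * ω := by
  have h0 : (0:ℝ) ∈ Icc (-1:ℝ) 1 := ⟨by norm_num, by norm_num⟩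
  -- first integration: `|g' σ - L σ - g' 0| ≤ ω |σ|` on `[-1, 1]`
  have hψ : ∀ σ ∈ Icc (-1:ℝ) 1, |g' σ - L * σ - g' 0| ≤ ω * |σ| := by
    intro σ hσ
    have key := Convex.norm_image_sub_le_of_norm_hasDerivWithin_le
      (f := fun τ => g' τ - τ * L) (f' := fun τ => g'' τ - L) (s := Icc (-1:ℝ) 1) (C := ω)
      (fun τ hτ => ((hg' τ hτ).sub (hasDerivAt_mul_const L)).hasDerivWithinAt)
      (fun τ hτ => by simpa [Real.norm_eq_abs] using hω τ hτ)
      (convex_Icc _ _) h0 hσ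
    rw [Real.norm_eq_abs, Real.norm_eq_abs, sub_zero] at key
    calc |g' σ - L * σ - g' 0| = |g' σ - σ * L - (g' 0 - 0 * L)| := by ring_nf
      _ ≤ ω * |σ| := key
  -- second integration on `[0, 1]`
  have hΨ : ∀ σ ∈ Icc (0:ℝ) 1, HasDerivWithinAt (fun τ => g τ + g (-τ) - L * τ ^ 2)
      (g' σ - g' (-σ) - 2 * L * σ) (Icc (0:ℝ) 1) σ := by
    intro σ hσ
    have hσ' : σ ∈ Icc (-1:ℝ) 1 := ⟨by linarith [hσ.1], hσ.2⟩
    have hnσ : -σ ∈ Icc (-1:ℝ) 1 := ⟨by linarith [hσ.2], by linarith [hσ.1]⟩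
    have h1 : HasDerivAt g (g' σ) σ := hg σ hσ'
    have h2 : HasDerivAt (fun τ => g (-τ)) (g' (-σ) * (-1)) σ :=
      (hg (-σ) hnσ).comp σ (hasDerivAt_neg σ)
    have h3 : HasDerivAt (fun τ => L * τ ^ 2) (L * (2 * σ)) σ := by
      simpa using (hasDerivAt_pow 2 σ).const_mul L
    have h4 : HasDerivAt (fun τ => g τ + g (-τ) - L * τ ^ 2)
        (g' σ + g' (-σ) * (-1) - L * (2 * σ)) σ := (h1.fun_add h2).fun_sub h3
    exact (h4.congr_deriv (by ring)).hasDerivWithinAt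
  have hbound : ∀ σ ∈ Ico (0:ℝ) 1, ‖g' σ - g' (-σ) - 2 * L * σ‖ ≤ 2 * ω := by
    intro σ hσ
    have hσ' : σ ∈ Icc (-1:ℝ) 1 := ⟨by linarith [hσ.1], hσ.2.le⟩
    have hnσ : -σ ∈ Icc (-1:ℝ) 1 := ⟨by linarith [hσ.2], by linarith [hσ.1]⟩
    have e1 := hψ σ hσ'
    have e2 := hψ (-σ) hnσ
    rw [abs_neg] at e2
    have hσabs : |σ| ≤ 1 := abs_le.2 ⟨by linarith [hσ.1], hσ.2.le⟩
    have hω0 : 0 ≤ ω := (abs_nonneg _).trans (hω 0 h0)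
    rw [Real.norm_eq_abs]
    calc |g' σ - g' (-σ) - 2 * L * σ|
        = |(g' σ - L * σ - g' 0) - (g' (-σ) - L * (-σ) - g' 0)| := by ring_nf
      _ ≤ |g' σ - L * σ - g' 0| + |g' (-σ) - L * (-σ) - g' 0| := abs_sub _ _
      _ ≤ ω * |σ| + ω * |σ| := add_le_add e1 e2
      _ ≤ ω * 1 + ω * 1 := by gcongr
      _ = 2 * ω := by ring
  have key := norm_image_sub_le_of_norm_deriv_le_segment_01' hΨ hbound
  rw [Real.norm_eq_abs] at key
  simp only [neg_zero, one_pow, mul_one] at key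
  calc |g 1 + g (-1) - 2 * g 0 - L|
      = |g 1 + g (-1) - L - (g 0 + g 0 - L * 0 ^ 2)| := by ring_nf
    _ ≤ 2 * ω := key

end OneDim

section LineDerivatives

variable {E : Type*} [NormedAddCommGroup E] [NormedSpace ℝ E]

/-- Derivative along the line `τ ↦ x + τ w` of a function differentiable at `x + σ w`:
`d/dτ F(x + τ w) = DF(x + σ w) w`. [folklore] -/
theorem hasDerivAt_comp_line_of_hasFDerivAt {F : E → ℝ} {x w : E} {σ : ℝ} {F' : E →L[ℝ] ℝ}
    (hF : HasFDerivAt F F' (x + σ • w)) :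
    HasDerivAt (fun τ : ℝ => F (x + τ • w)) (F' w) σ := by
  have hl : HasDerivAt (fun τ : ℝ => x + τ • w) w σ := by
    simpa using ((hasDerivAt_id σ).smul_const w).const_add x
  exact hF.comp_hasDerivAt σ hl

/-- Second derivative along a line: if `F` is `C²` at `x + σ w` then
`d/dτ (DF(x + τ w) w) = D²F(x + σ w)(w, w)` at `τ = σ`. [folklore] -/
theorem hasDerivAt_fderiv_comp_line_of_contDiffAt {F : E → ℝ} {x w : E} {σ : ℝ}
    (hF : ContDiffAt ℝ 2 F (x + σ • w)) :
    HasDerivAt (fun τ : ℝ => fderiv ℝ F (x + τ • w) w)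
      (iteratedFDeriv ℝ 2 F (x + σ • w) ![w, w]) σ := by
  have h1 : ContDiffAt ℝ 1 (fderiv ℝ F) (x + σ • w) := hF.fderiv_right (m := 1) (by norm_num)
  have h2 : HasFDerivAt (fderiv ℝ F) (fderiv ℝ (fderiv ℝ F) (x + σ • w)) (x + σ • w) :=
    (h1.differentiableAt (by norm_num)).hasFDerivAt
  have h3 : HasFDerivAt (fun y => fderiv ℝ F y w)
      ((fderiv ℝ (fderiv ℝ F) (x + σ • w)).flip w) (x + σ • w) := by
    have := h2.clm_apply (hasFDerivAt_const w (x + σ • w))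
    simpa using this
  have h4 := hasDerivAt_comp_line_of_hasFDerivAt (F := fun y => fderiv ℝ F y w) h3
  rw [iteratedFDeriv_two_apply]
  simpa using h4

/-- **Symmetric second difference vs. second derivative.** If `F` is `C²` along the segment
`[x - w, x + w]` and `|D²F(x + σw)(w,w) - D²F(x)(w,w)| ≤ ω` for `σ ∈ [-1, 1]`, then
`|F(x + w) + F(x - w) - 2F(x) - D²F(x)(w, w)| ≤ 2ω`. [folklore] -/
theorem abs_second_difference_sub_iteratedFDeriv_le {F : E → ℝ} {x w : E} {ω : ℝ}
    (hF : ∀ σ ∈ Icc (-1:ℝ) 1, ContDiffAt ℝ 2 F (x + σ • w))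
    (hω : ∀ σ ∈ Icc (-1:ℝ) 1,
      |iteratedFDeriv ℝ 2 F (x + σ • w) ![w, w] - iteratedFDeriv ℝ 2 F x ![w, w]| ≤ ω) :
    |F (x + w) + F (x - w) - 2 * F x - iteratedFDeriv ℝ 2 F x ![w, w]| ≤ 2 * ω := by
  have key := abs_second_difference_sub_le (g := fun τ => F (x + τ • w))
    (g' := fun τ => fderiv ℝ F (x + τ • w) w)
    (g'' := fun τ => iteratedFDeriv ℝ 2 F (x + τ • w) ![w, w])
    (L := iteratedFDeriv ℝ 2 F x ![w, w]) (ω := ω)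
    (fun σ hσ => hasDerivAt_comp_line_of_hasFDerivAt ((hF σ hσ).differentiableAt (by norm_num)).hasFDerivAt)
    (fun σ hσ => hasDerivAt_fderiv_comp_line_of_contDiffAt (hF σ hσ)) hω
  simpa only [one_smul, neg_smul, zero_smul, add_zero, ← sub_eq_add_neg] using key

end LineDerivatives

section Stencil

variable {E : Type*} [NormedAddCommGroup E] [InnerProductSpace ℝ E] [FiniteDimensional ℝ E]
variable {ι : Type*} [Fintype ι]

omit [FiniteDimensional ℝ E] in
/-- Homogeneity of the second derivative in its two (equal) arguments:
`D²F(y)(hv, hv) = h² D²F(y)(v, v)`. [folklore] -/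
theorem iteratedFDeriv_two_smul_smul (F : E → ℝ) (y v : E) (h : ℝ) :
    iteratedFDeriv ℝ 2 F y ![h • v, h • v] = h ^ 2 * iteratedFDeriv ℝ 2 F y ![v, v] := by
  have : (![h • v, h • v] : Fin 2 → E) = fun j => h • (![v, v] : Fin 2 → E) j := by
    funext j; fin_cases j <;> simp
  rw [this, ContinuousMultilinearMap.map_smul_univ]
  simp [pow_two]

/-- **The `2d + 1`-point stencil and the Laplacian.** For an orthonormal basis `b` of `E`, a
function `F` which is `C²` along the `2·card ι` stencil segments at `x`, and `ω` bounding the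
oscillation of the second derivatives `D²F(·)(bᵢ, bᵢ)` along them,
`|Σᵢ (F(x + h bᵢ) + F(x - h bᵢ) - 2F(x)) - h² ΔF(x)| ≤ 2 (card ι) h² ω`
(`Δ F(x) = Σᵢ D²F(x)(bᵢ, bᵢ)`, `laplacian_eq_iteratedFDeriv_orthonormalBasis`). [folklore] -/
theorem abs_stencil_sub_laplacian_le (b : OrthonormalBasis ι ℝ E) {F : E → ℝ} {x : E} {h ω : ℝ}
    (hF : ∀ i, ∀ σ ∈ Icc (-1:ℝ) 1, ContDiffAt ℝ 2 F (x + σ • h • b i))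
    (hω : ∀ i, ∀ σ ∈ Icc (-1:ℝ) 1,
      |iteratedFDeriv ℝ 2 F (x + σ • h • b i) ![b i, b i] -
        iteratedFDeriv ℝ 2 F x ![b i, b i]| ≤ ω) :
    |∑ i, (F (x + h • b i) + F (x - h • b i) - 2 * F x) - h ^ 2 * (Δ F) x| ≤
      2 * Fintype.card ι * (h ^ 2 * ω) := by
  rw [laplacian_eq_iteratedFDeriv_orthonormalBasis F b]
  simp only
  rw [Finset.mul_sum, ← Finset.sum_sub_distrib]
  calc |∑ i, (F (x + h • b i) + F (x - h • b i) - 2 * F x -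
          h ^ 2 * iteratedFDeriv ℝ 2 F x ![b i, b i])|
      ≤ ∑ i, |F (x + h • b i) + F (x - h • b i) - 2 * F x -
          h ^ 2 * iteratedFDeriv ℝ 2 F x ![b i, b i]| := Finset.abs_sum_le_sum_abs _ _
    _ ≤ ∑ _i : ι, 2 * (h ^ 2 * ω) := Finset.sum_le_sum fun i _ => ?_
    _ = 2 * Fintype.card ι * (h ^ 2 * ω) := by
        simp only [Finset.sum_const, Finset.card_univ, nsmul_eq_mul]; ring
  -- per-direction estimate with `w = h • b i`
  have key := abs_second_difference_sub_iteratedFDeriv_le (F := F) (x := x) (w := h • b i)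
    (ω := h ^ 2 * ω) (hF i) ?_
  · rw [iteratedFDeriv_two_smul_smul] at key; exact key
  · intro σ hσ
    rw [iteratedFDeriv_two_smul_smul, iteratedFDeriv_two_smul_smul, ← mul_sub, abs_mul,
      abs_of_nonneg (sq_nonneg h)]
    exact mul_le_mul_of_nonneg_left (hω i σ hσ) (sq_nonneg h)

variable (b : ι → E)

omit [FiniteDimensional ℝ E] in
/-- The stencil of a globally `C^n` function is `C^n`. [folklore] -/
theorem contDiff_stencil {k : E → ℝ} {n : WithTop ℕ∞} (hk : ContDiff ℝ n k) (h : ℝ) :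
    ContDiff ℝ n (fun q => ∑ j, (k (q + h • b j) + k (q - h • b j) - 2 * k q)) := by
  refine ContDiff.sum fun j _ => ?_
  exact ((hk.comp (contDiff_id.add contDiff_const)).add
    (hk.comp (contDiff_id.sub contDiff_const))).sub (contDiff_const.mul hk)

omit [FiniteDimensional ℝ E] in
/-- **The second derivatives of the stencil are the stencil of the second derivatives** (for a
globally `C²` function; translations commute with derivatives). [folklore] -/
theorem iteratedFDeriv_two_stencil_apply {k : E → ℝ} (hk : ContDiff ℝ 2 k) (h : ℝ) (p : E)
    (m : Fin 2 → E) :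
    iteratedFDeriv ℝ 2 (fun q => ∑ j, (k (q + h • b j) + k (q - h • b j) - 2 * k q)) p m =
      ∑ j, (iteratedFDeriv ℝ 2 k (p + h • b j) m + iteratedFDeriv ℝ 2 k (p - h • b j) m -
        2 * iteratedFDeriv ℝ 2 k p m) := by
  have h1 : ∀ j, ContDiff ℝ 2 (fun q => k (q + h • b j)) := fun j =>
    hk.comp (contDiff_id.add contDiff_const)
  have h2 : ∀ j, ContDiff ℝ 2 (fun q => k (q - h • b j)) := fun j =>
    hk.comp (contDiff_id.sub contDiff_const)
  have h3 : ContDiff ℝ 2 (fun q => (2:ℝ) * k q) := contDiff_const.mul hk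
  rw [iteratedFDeriv_fun_sum_apply (f := fun j q => k (q + h • b j) + k (q - h • b j) - 2 * k q)
    (fun j _ => (((h1 j).add (h2 j)).sub h3).contDiffAt)]
  rw [sum_apply]
  refine Finset.sum_congr rfl fun j _ => ?_
  rw [fun_iteratedFDeriv_sub_apply ((h1 j).add (h2 j)).contDiffAt h3.contDiffAt,
    fun_iteratedFDeriv_add_apply (h1 j).contDiffAt (h2 j).contDiffAt,
    iteratedFDeriv_comp_add_right, iteratedFDeriv_comp_sub]
  have e3 : (fun q => (2:ℝ) * k q) = (2:ℝ) • k := by funext q; simp [smul_eq_mul]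
  rw [e3, iteratedFDeriv_const_smul_apply hk.contDiffAt]
  simp [smul_eq_mul]

/-- **The Laplacian of the stencil is the stencil of the Laplacian** (globally `C²` function).
[folklore] -/
theorem laplacian_stencil {k : E → ℝ} (hk : ContDiff ℝ 2 k) (h : ℝ) (p : E) :
    (Δ (fun q => ∑ j, (k (q + h • b j) + k (q - h • b j) - 2 * k q))) p =
      ∑ j, ((Δ k) (p + h • b j) + (Δ k) (p - h • b j) - 2 * (Δ k) p) := by
  rw [laplacian_eq_iteratedFDeriv_stdOrthonormalBasis,
    laplacian_eq_iteratedFDeriv_stdOrthonormalBasis]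
  simp only [iteratedFDeriv_two_stencil_apply b hk]
  rw [Finset.sum_comm]
  simp only [Finset.sum_add_distrib, Finset.sum_sub_distrib, Finset.mul_sum]

end Stencil


section DoubleStencil

variable {E : Type*} [NormedAddCommGroup E] [InnerProductSpace ℝ E] [FiniteDimensional ℝ E]
variable {ι : Type*} [Fintype ι]

/-- **The double stencil of a harmonic function is `o(h⁴)`, locally uniformly.** For `k ∈ C⁴(E)`
with `Δk = 0` on an open `U ⊇ K` (`K` compact), orthonormal bases `b, b'`, and the inner stencil
`F_h(q) = Σⱼ (k(q + h bⱼ) + k(q - h bⱼ) - 2k(q))`: for every `ε > 0` there is `h₀ > 0` with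
`|Σᵢ (F_h(z + h b'ᵢ) + F_h(z - h b'ᵢ) - 2F_h(z))| ≤ ε h⁴` for `z ∈ K`, `0 < h < h₀`. (The outer
stencil of `F_h` is `h² ΔF_h(z) = h² F_h[Δk](z) = 0` up to `2 (card ι) h²` times the oscillation of
`D²F_h(·)(b'ᵢ,b'ᵢ) = F_h[D²k(·)(b'ᵢ,b'ᵢ)]`, itself `≤ 5 (card ι) h² ε'` by uniform continuity of the
fourth derivatives on a compact neighbourhood of `K`; no harmonicity of derivatives of `k`.) [folklore] -/
theorem abs_double_stencil_le_of_laplacian_eq_zero (b b' : OrthonormalBasis ι ℝ E) {k : E → ℝ}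
    (hk : ContDiff ℝ 4 k) {U : Set E} (hU : IsOpen U) (hΔ : ∀ z ∈ U, (Δ k) z = 0) {K : Set E}
    (hK : IsCompact K) (hKU : K ⊆ U) (F : ℝ → E → ℝ)
    (hF : ∀ h q, F h q = ∑ j, (k (q + h • b j) + k (q - h • b j) - 2 * k q)) {ε : ℝ}
    (hε : 0 < ε) :
    ∃ h₀ : ℝ, 0 < h₀ ∧ ∀ z ∈ K, ∀ h : ℝ, 0 < h → h < h₀ →
      |∑ i, (F h (z + h • b' i) + F h (z - h • b' i) - 2 * F h z)| ≤ ε * h ^ 4 := by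
  classical
  obtain ⟨δ, hδ, hK₁U⟩ := hK.exists_cthickening_subset_open hU hKU
  set K₁ : Set E := Metric.cthickening δ K with hK₁def
  have hK₁ : IsCompact K₁ := hK.cthickening
  have hmem : ∀ z ∈ K, ∀ v : E, ‖v‖ ≤ δ → z + v ∈ K₁ := fun z hz v hv =>
    Metric.mem_cthickening_of_dist_le (z + v) z δ K hz (by simpa [dist_eq_norm] using hv)
  have hk2 : ContDiff ℝ 2 k := hk.of_le (by norm_num)
  have hki : ∀ i, ContDiff ℝ 2 (fun q => iteratedFDeriv ℝ 2 k q ![b' i, b' i]) := fun i => by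
    have h2 : ContDiff ℝ 2 (iteratedFDeriv ℝ 2 k) :=
      hk.iteratedFDeriv_right (m := 2) (i := 2) (le_of_eq (by norm_cast))
    exact (ContinuousMultilinearMap.apply ℝ (fun _ : Fin 2 => E) ℝ ![b' i, b' i]).contDiff.comp h2
  -- the fourth derivatives `f i j` and their uniform continuity on `K₁`
  obtain ⟨f, hf⟩ : ∃ f : ι → ι → E → ℝ, ∀ i j p, f i j p =
      iteratedFDeriv ℝ 2 (fun q => iteratedFDeriv ℝ 2 k q ![b' i, b' i]) p ![b j, b j] :=
    ⟨_, fun _ _ _ => rfl⟩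
  have hfc : ∀ i j, Continuous (f i j) := fun i j => by
    have hc : Continuous fun p => iteratedFDeriv ℝ 2
        (fun q => iteratedFDeriv ℝ 2 k q ![b' i, b' i]) p :=
      (hki i).continuous_iteratedFDeriv le_rfl
    have := (ContinuousMultilinearMap.apply ℝ (fun _ : Fin 2 => E) ℝ ![b j, b j]).continuous.comp hc
    refine this.congr fun p => ?_
    simp [hf]
  set G : E → (ι × ι → ℝ) := fun p ij => f ij.1 ij.2 p with hGdef
  have hGc : Continuous G := continuous_pi fun ij => hfc ij.1 ij.2
  set ε' : ℝ := ε / (10 * (Fintype.card ι : ℝ) ^ 2 + 1) with hε'def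
  have hε' : 0 < ε' := by positivity
  obtain ⟨δ₁, hδ₁, hGu⟩ := Metric.uniformContinuousOn_iff.1
    (hK₁.uniformContinuousOn_of_continuous hGc.continuousOn) ε' hε'
  have hfε : ∀ i j, ∀ p ∈ K₁, ∀ q ∈ K₁, dist p q < δ₁ → |f i j p - f i j q| ≤ ε' := by
    intro i j p hp q hq hpq
    have h1 := hGu p hp q hq hpq
    have h2 := dist_le_pi_dist (G p) (G q) (i, j)
    rw [Real.dist_eq] at h2
    exact h2.trans h1.le
  -- the inner stencil operator
  obtain ⟨T, hT⟩ : ∃ T : (E → ℝ) → ℝ → E → ℝ, ∀ g h p,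
      T g h p = ∑ j, (g (p + h • b j) + g (p - h • b j) - 2 * g p) := ⟨_, fun _ _ _ => rfl⟩
  refine ⟨min (δ / 2) δ₁, lt_min (half_pos hδ) hδ₁, fun z hz h hh hh₀ => ?_⟩
  have hhδ : h ≤ δ / 2 := (hh₀.trans_le (min_le_left _ _)).le
  have hhδ₁ : h < δ₁ := hh₀.trans_le (min_le_right _ _)
  have hn1 : ∀ i, ‖b i‖ = 1 := fun i => b.orthonormal.1 i
  have hn1' : ∀ i, ‖b' i‖ = 1 := fun i => b'.orthonormal.1 i
  have hsmall : ∀ σ ∈ Icc (-1:ℝ) 1, ∀ v : E, ‖v‖ = 1 → ‖σ • h • v‖ ≤ h := by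
    intro σ hσ v hv
    rw [norm_smul, norm_smul, hv, mul_one, Real.norm_eq_abs, Real.norm_eq_abs, abs_of_pos hh]
    have : |σ| ≤ 1 := abs_le.2 ⟨hσ.1, hσ.2⟩
    nlinarith
  have hFh : F h = T k h := funext fun q => by rw [hF, hT]
  -- (C) oscillation of the inner stencil of `k_i = D²k(·)(b'ᵢ, b'ᵢ)` between `p` and `z`
  have stepC : ∀ i, ∀ σ ∈ Icc (-1:ℝ) 1,
      |T (fun q => iteratedFDeriv ℝ 2 k q ![b' i, b' i]) h (z + σ • h • b' i) -
        T (fun q => iteratedFDeriv ℝ 2 k q ![b' i, b' i]) h z| ≤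
        5 * Fintype.card ι * (h ^ 2 * ε') := by
    intro i σ hσ
    set kᵢ : E → ℝ := fun q => iteratedFDeriv ℝ 2 k q ![b' i, b' i] with hkᵢ
    set p : E := z + σ • h • b' i with hp
    have hpK : p ∈ K₁ := hmem z hz _ ((hsmall σ hσ _ (hn1' i)).trans (by linarith))
    have hzK : z ∈ K₁ := by simpa using hmem z hz 0 (by simp [hδ.le])
    have cons : ∀ x : E, (∀ τ ∈ Icc (-1:ℝ) 1, ∀ j, x + τ • h • b j ∈ K₁) → x ∈ K₁ →
        |T kᵢ h x - h ^ 2 * (Δ kᵢ) x| ≤ 2 * Fintype.card ι * (h ^ 2 * ε') := by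
      intro x hx hxK
      rw [hT]
      refine abs_stencil_sub_laplacian_le b (fun j τ _ => (hki i).contDiffAt) fun j τ hτ => ?_
      rw [← hf, ← hf]
      refine hfε i j _ (hx τ hτ j) _ hxK ?_
      rw [dist_eq_norm, add_sub_cancel_left]
      exact (hsmall τ hτ _ (hn1 j)).trans_lt hhδ₁
    have hpx : ∀ τ ∈ Icc (-1:ℝ) 1, ∀ j, p + τ • h • b j ∈ K₁ := by
      intro τ hτ j
      rw [hp, add_assoc]
      refine hmem z hz _ ((norm_add_le _ _).trans ?_)
      linarith [hsmall σ hσ _ (hn1' i), hsmall τ hτ _ (hn1 j)]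
    have hzx : ∀ τ ∈ Icc (-1:ℝ) 1, ∀ j, z + τ • h • b j ∈ K₁ := fun τ hτ j =>
      hmem z hz _ ((hsmall τ hτ _ (hn1 j)).trans (by linarith))
    have c1 := cons p hpx hpK
    have c2 := cons z hzx hzK
    -- `|Δkᵢ(p) - Δkᵢ(z)| ≤ card ι · ε'`
    have c3 : |(Δ kᵢ) p - (Δ kᵢ) z| ≤ Fintype.card ι * ε' := by
      rw [laplacian_eq_iteratedFDeriv_orthonormalBasis kᵢ b]
      simp only
      rw [← Finset.sum_sub_distrib]
      refine (Finset.abs_sum_le_sum_abs _ _).trans ?_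
      calc ∑ j, |iteratedFDeriv ℝ 2 kᵢ p ![b j, b j] - iteratedFDeriv ℝ 2 kᵢ z ![b j, b j]|
          ≤ ∑ _j : ι, ε' := Finset.sum_le_sum fun j _ => ?_
        _ = Fintype.card ι * ε' := by
            simp only [Finset.sum_const, Finset.card_univ, nsmul_eq_mul]
      rw [← hf, ← hf]
      refine hfε i j p hpK z hzK ?_
      rw [hp, dist_eq_norm, add_sub_cancel_left]
      exact (hsmall σ hσ _ (hn1' i)).trans_lt hhδ₁
    have hh2 : 0 ≤ h ^ 2 := sq_nonneg h
    calc |T kᵢ h p - T kᵢ h z|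
        = |(T kᵢ h p - h ^ 2 * (Δ kᵢ) p) - (T kᵢ h z - h ^ 2 * (Δ kᵢ) z) +
            h ^ 2 * ((Δ kᵢ) p - (Δ kᵢ) z)| := by ring_nf
      _ ≤ |T kᵢ h p - h ^ 2 * (Δ kᵢ) p| + |T kᵢ h z - h ^ 2 * (Δ kᵢ) z| +
            |h ^ 2 * ((Δ kᵢ) p - (Δ kᵢ) z)| := by
          exact (abs_add_le _ _).trans (add_le_add (abs_sub _ _) le_rfl)
      _ ≤ 2 * Fintype.card ι * (h ^ 2 * ε') + 2 * Fintype.card ι * (h ^ 2 * ε') +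
            h ^ 2 * (Fintype.card ι * ε') := by
          rw [abs_mul, abs_of_nonneg hh2]
          exact add_le_add (add_le_add c1 c2) (mul_le_mul_of_nonneg_left c3 hh2)
      _ = 5 * Fintype.card ι * (h ^ 2 * ε') := by ring
  -- (A) + (B): the outer stencil of `F h = T k h` at `z`, whose Laplacian vanishes at `z`
  have hF2 : ContDiff ℝ 2 (F h) := by rw [hFh, funext (hT k h)]; exact contDiff_stencil b hk2 h
  have hΔF : (Δ (F h)) z = 0 := by
    rw [hFh, funext (hT k h), laplacian_stencil b hk2 h z]
    refine Finset.sum_eq_zero fun j _ => ?_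
    have hhb : ‖h • b j‖ ≤ δ := by
      rw [norm_smul, hn1 j, mul_one, Real.norm_eq_abs, abs_of_pos hh]; linarith
    have h1 : z + h • b j ∈ U := hK₁U (hmem z hz _ hhb)
    have h2 : z - h • b j ∈ U := by
      rw [sub_eq_add_neg]; exact hK₁U (hmem z hz _ (by rw [norm_neg]; exact hhb))
    rw [hΔ _ h1, hΔ _ h2, hΔ _ (hKU hz)]
    ring
  have hA := abs_stencil_sub_laplacian_le b' (F := F h) (x := z) (h := h)
    (ω := 5 * Fintype.card ι * (h ^ 2 * ε')) (fun i σ _ => hF2.contDiffAt) (fun i σ hσ => by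
      rw [hFh, funext (hT k h), iteratedFDeriv_two_stencil_apply b hk2,
        iteratedFDeriv_two_stencil_apply b hk2]
      have := stepC i σ hσ
      rw [hT, hT] at this
      exact this)
  rw [hΔF, mul_zero, sub_zero] at hA
  refine hA.trans ?_
  have hcard : (0:ℝ) ≤ Fintype.card ι := Nat.cast_nonneg _
  have key : 10 * (Fintype.card ι : ℝ) ^ 2 * ε' ≤ ε := by
    rw [hε'def, mul_div_assoc']  -- 10 c² ε / (10 c² + 1) ≤ ε
    rw [div_le_iff₀ (by positivity)]
    nlinarith
  calc 2 * (Fintype.card ι : ℝ) * (h ^ 2 * (5 * Fintype.card ι * (h ^ 2 * ε')))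
      = (10 * (Fintype.card ι : ℝ) ^ 2 * ε') * h ^ 4 := by ring
    _ ≤ ε * h ^ 4 := by gcongr

end DoubleStencil

end Literature.Analysis.FluidPDE

end
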